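/-
Copyright (c) 2026 the pub-hodgecm-mathlib formalisation cell (harness21).  Prover seat hodgecm-mathlib-LH4-p14 (g4): Track A «(D-RAM) FOUR-FRAME» squad of crux H413, unit U2H (ii-H),
(ρ2b′-X) payer of record (heir) — SOCKET (C) PEELED ONCE: the signed census at one place from the FRAME CENSUS (the same census stated over ★ p857432's eigen-package, which
this file constructs and instantiates at the CM place), payer MAP v2 bde9a80f seam S2 ∕ (C0a), 2026-09-04.
-/
import Summits.HodgeConjecture.HodgeConjecture.Theorems.F0P3cDyRamFixedPointCensusTypeTwoPrelude     -- ★ p857439: brings every token of :418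
import Summits.HodgeConjecture.HodgeConjecture.Theorems.F0P3cDyRamEigenFieldPackageTypeTwo          -- ★ p857432 (F0P3a-p01 (g33)): `exists_eigenPackage` (T3-E A ∘ B ∘ C)
import Literature.NumberTheory.NumberFields.QuadraticCompletionAtNonsplitPlace                    -- ★ (QM): `AdjoinRoot (X² − C m)` is a quadratic number field, `exists_algEquiv_root_eq_neg`, …
import Literature.NumberTheory.NumberFields.RamifiedQuadraticDictionaryWild                       -- ★ `exists_isSquare_inv_mul_coe_of_ne_zero` (a global representative of a local square class, any place)
import Literature.NumberTheory.Rogawski1990.TypeTwoCayleyShiftCM                                 -- ★ `transpose_map_fst_evalRingHom_mul` (`g_w` is unitary for `Φ₂,w`)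
import Literature.NumberTheory.Rogawski1990.UnitaryTwoTypeTwoEdgeCount                           -- ★ `placeForm_antidiagTwo_eq_antidiag`
import Literature.NumberTheory.Rogawski1990.TypeTwoOnePlaceDataAlgebra                           -- ★ `det_mul_map_det_eq_one_of_unitary_antidiag`, `map_trace_mul_det_eq_trace_of_unitary_antidiag`
import HarnessLib

/-!
# F0 · P3c · line LH4 «(D-RAM) FOUR-FRAME» — unit (ii-H), leaf (ρ2b′-X): SOCKET (C) FROM THE FRAME CENSUS (the eigen-package constructed and instantiated at the CM place)
(Rogawski 1990 §4.9; Labesse–Langlands 1979 §2; Lang, Algebra VI §9; Neukirch 1999 II (8.2))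

Cell `pub/hodgecm-mathlib`, crux H413 = `stmt-HodgeConjecture-24833` (helper lane, count-neutral); THEOREMS ONLY (no definition, no instance, no notation, no named fact, no `sorry`,
default heartbeats), typed under the LINE FILE's scopes.  Socket served: the binder `hCensus` of `…OfOrgans.hOrgNV_at_of_literal_and_census` (ED. 2 of ★ p857565, dyadic letters: the two residual-anisotropy clauses struck, REF5 R5-174) (payer MAP v2 `F0/P3c/LH4/LH4-p14/g4/
HEAD-OF-ORGANS-MAP.v2.LH4p14g4.md` bde9a80f, socket text `SOCKET-hCensus.v2.LH4p14g4.txt`; its `d, ϖ` are the datum's).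

WHAT IS PROVED: **`hCensus_at_of_frameCensus (hFrame) : ‹socket (C) at (L, w, ϖ, d)›`** — the signed census of a literal pair at one place, from the SAME census stated OVER THE
EIGEN-PACKAGE (`hFrame`: for every global quadratic model `E′ = L(√m₀)` with its `L`-involution `c₁` and `δ = √m₀`, every `c₁`-fixed place `w₁ ∣ w` and every `(Θ, α, λ, s)`
satisfying the conclusions of ★ p857432 `exists_eigenPackage` at `σ := σ_w`, `t := tr g_w`, `D := det g_w` — the census holds).  This file DISCHARGES, for every `G`-regular
type-(2) `γ_H` near `1`: `g_w` unitary for `Φ₂,w` (★ `transpose_map_fst_evalRingHom_mul`) ⇒ `D·σD = 1`, `t = D·σt` (★ `TypeTwoOnePlaceDataAlgebra`); type (2) ⇒ `χ_g(x) ≠ 0 ∀ x`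
(Mathlib `charpoly_fin_two`) ⇒ `Δ = t² − 4D ≠ 0`; a global `m₀ ∈ L` with `Δ⁻¹m₀ ∈ (L_wˣ)²` (★ `exists_isSquare_inv_mul_coe_of_ne_zero`), `m₀ ∉ (L_w)²` (else a root), `m₀ ∉ L²`;
`E′ := AdjoinRoot (X² − C m₀)` with its non-trivial `L`-automorphism (★ (QM)); `s := r⁻¹` with `Δ = s²·m₀`; then ★ `exists_eigenPackage` and `hFrame`.  So the next socket
(C′) = `hFrame` (text `SOCKET-hFrame.v1.LH4p14g4.txt`) is stated over concrete `(E′, w₁, ι_{w₁}, c_{w₁}, Θ, α, λ)` — the letters of ★ (C1) p857559, ★ (C) p857215, ★ W4 p857271,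
the T5 heads and ★ T5s p857461∕p857558.

HONEST LABEL: HC_CM is proved only modulo the 7 printed citations (2 remaining named inputs: hLiu418 = stmt-HodgeConjecture-24832, h413 = stmt-HodgeConjecture-24833) until rung 0
closes; this file is a reduction (count-neutral) — `hFrame` is the OPEN frame-census socket (payer (C0b) over bricks (C1)(C2), (α)(β), S2′, S6–S9 of the MAP); nothing in it is
asserted here.

## References
* [Rogawski1990] J. D. Rogawski, *Automorphic Representations of Unitary Groups in Three Variables*, Ann. of Math. Stud. 123 (1990), §3.1 p. 19; §4.9 Prop. 4.9.1 (b) p. 55, Lemma 4.9.3 p. 56.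
* [LabesseLanglands1979] J.-P. Labesse, R. P. Langlands, *L-indistinguishability for SL(2)*, Canad. J. Math. 31 (1979), §2 p. 8.
* [Lang2002] S. Lang, *Algebra*, GTM 211 (2002), Ch. VI §9 Thm. 9.1.
* [NeukirchANT1999] J. Neukirch, *Algebraic Number Theory*, GMW 322 (1999), Ch. II (8.2)–(8.3).
-/

set_option autoImplicit false

noncomputable section

namespace Summit.HodgeConjecture.HodgeConjecture.Cruxes.H413.F0P3cDyRamFixedPointCensusTypeTwoCensusOfFrame

-- THE LINES MODULE'S `open` CONTEXT (tree `Cruxes/H413/Lines/F0_P3c_DyRamFourFrame_U2H_HSide.lean`, after its `namespace`):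
open MeasureTheory Measure NumberField IsDedekindDomain Topology Filter Polynomial
open Literature.NumberTheory.Automorphic Literature.NumberTheory.Automorphic.UnitaryGroup Literature.NumberTheory.Automorphic.IntegralReduction
open Literature.NumberTheory.Rogawski1990 Literature.NumberTheory.GaloisRepresentations Literature.NumberTheory.NumberFields
open Literature.NumberTheory.Automorphic.UnitaryThreeFourFrame
open Summit.HodgeConjecture.HodgeConjecture.Cruxes.H413.F0P3cDyRamFourFrameHSideDefs
open Summit.HodgeConjecture.HodgeConjecture.Cruxes.H413.F0P3cDyRamFourFrameHFamilyDefs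
open scoped Matrix MatrixGroups Classical ValuativeRel
open Summit.HodgeConjecture.HodgeConjecture.Cruxes.H413.F0P3cDyRamFourFrameHSideDefsR
open Summit.HodgeConjecture.HodgeConjecture.Cruxes.H413.F0P3cDyRamFourFrameLawDefsR (shiftT shiftR)
open Literature.NumberTheory.Automorphic.UnitaryLatticeTree Literature.NumberTheory.Automorphic.HermitianLattice
open Literature.NumberTheory.QuadraticForms
open Summit.HodgeConjecture.HodgeConjecture.Cruxes.H413

set_option maxHeartbeats 400000 in
-- budget only: statement-heavy tokens (the frame socket quantifies over a quadratic number field and the 23 eigen-package conclusions).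
/-- **SOCKET (C) FROM THE FRAME CENSUS** — see the module docstring.  The frame-census socket `hFrame` quantifies over every global quadratic model and every eigen-package
instance in the letters of ★ `exists_eigenPackage`; this head builds one such instance for each `G`-regular type-(2) `γ_H` and applies it.
[cite: Rogawski1990, §3.1 p. 19; §4.9 Prop. 4.9.1 (b) p. 55, Lemma 4.9.3 p. 56] [cite: LabesseLanglands1979, §2 p. 8] [cite: Lang2002, Ch. VI §9 Thm. 9.1] [cite: NeukirchANT1999, Ch. II (8.2)–(8.3)] -/
theorem hCensus_at_of_frameCensus (L : Type) [Field L] [NumberField L] [IsCMField L]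
    {v : HeightOneSpectrum (𝓞 ↥(maximalRealSubfield L))} (w : UnitaryGroup.PlacesOver L v)
    (hw : IsCMField.complexConj L • w.1 = w.1) (ϖ : (w.1.adicCompletion L)) (d : ℕ)
    [Fintype (Valued.ResidueField (w.1.adicCompletion L))]
    (hFrame :
      ∃ V ∈ 𝓝 (1 : ((UnitaryGroup.cmDatum L 2 (Matrix.of fun i j : Fin 2 => if i.val + j.val + 1 = 2 then (1 : L) else 0)).Local v × (UnitaryGroup.cmDatum L 1 (Matrix.of fun i j : Fin 1 => if i.val + j.val + 1 = 1 then (1 : L) else 0)).Local v)), ∀ γH ∈ V, IsLocalGRegular L v γH →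
        ¬ (∃ x : (w.1.adicCompletion L), (((((γH).1.val : GL (Fin 2) (UnitaryGroup.LocalRing L v)).val.map (Pi.evalRingHom (fun w' : UnitaryGroup.PlacesOver L v => w'.1.adicCompletion L) w))).charpoly).IsRoot x) →
        ∀ (E' : Type) [Field E'] [NumberField E'] [Algebra L E'] [Algebra.IsQuadraticExtension L E'] (c₁ : E' ≃ₐ[L] E') (δ : E') (m₀ : L)
          (s : (w.1.adicCompletion L)) (w₁ : UnitaryGroup.PlacesOver E' w.1) (hw₁ : c₁ • w₁.1 = w₁.1)
          (Θ : (w₁.1.adicCompletion E') →+* (w₁.1.adicCompletion E')) (α lam : (w₁.1.adicCompletion E')),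
          c₁ ≠ 1 → c₁ δ = -δ → δ ≠ 0 → algebraMap L E' m₀ = δ ^ 2 → s ≠ 0 →
          (((γH.1.val : GL (Fin 2) (UnitaryGroup.LocalRing L v)).val.map (Pi.evalRingHom (fun w' : UnitaryGroup.PlacesOver L v => w'.1.adicCompletion L) w))).trace * (((γH.1.val : GL (Fin 2) (UnitaryGroup.LocalRing L v)).val.map (Pi.evalRingHom (fun w' : UnitaryGroup.PlacesOver L v => w'.1.adicCompletion L) w))).trace - 4 * (((γH.1.val : GL (Fin 2) (UnitaryGroup.LocalRing L v)).val.map (Pi.evalRingHom (fun w' : UnitaryGroup.PlacesOver L v => w'.1.adicCompletion L) w))).det = s * s * ((m₀ : L) : (w.1.adicCompletion L)) →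
          (((γH.1.val : GL (Fin 2) (UnitaryGroup.LocalRing L v)).val.map (Pi.evalRingHom (fun w' : UnitaryGroup.PlacesOver L v => w'.1.adicCompletion L) w))).det * (galAdicCompletionMap (L := L) (IsCMField.complexConj L) hw) (((γH.1.val : GL (Fin 2) (UnitaryGroup.LocalRing L v)).val.map (Pi.evalRingHom (fun w' : UnitaryGroup.PlacesOver L v => w'.1.adicCompletion L) w))).det = 1 → (((γH.1.val : GL (Fin 2) (UnitaryGroup.LocalRing L v)).val.map (Pi.evalRingHom (fun w' : UnitaryGroup.PlacesOver L v => w'.1.adicCompletion L) w))).trace = (((γH.1.val : GL (Fin 2) (UnitaryGroup.LocalRing L v)).val.map (Pi.evalRingHom (fun w' : UnitaryGroup.PlacesOver L v => w'.1.adicCompletion L) w))).det * (galAdicCompletionMap (L := L) (IsCMField.complexConj L) hw) (((γH.1.val : GL (Fin 2) (UnitaryGroup.LocalRing L v)).val.map (Pi.evalRingHom (fun w' : UnitaryGroup.PlacesOver L v => w'.1.adicCompletion L) w))).trace →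
          (∀ x : (w.1.adicCompletion L), x * x - (((γH.1.val : GL (Fin 2) (UnitaryGroup.LocalRing L v)).val.map (Pi.evalRingHom (fun w' : UnitaryGroup.PlacesOver L v => w'.1.adicCompletion L) w))).trace * x + (((γH.1.val : GL (Fin 2) (UnitaryGroup.LocalRing L v)).val.map (Pi.evalRingHom (fun w' : UnitaryGroup.PlacesOver L v => w'.1.adicCompletion L) w))).det ≠ 0) →
          (∀ z, galAdicCompletionMap (L := E') c₁ hw₁ (galAdicCompletionMap (L := E') c₁ hw₁ z) = z) →
          (∀ z, Valued.v (galAdicCompletionMap (L := E') c₁ hw₁ z) = Valued.v z) →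
          (∀ a, galAdicCompletionMap (L := E') c₁ hw₁ (toPlace w.1 w₁ a) = toPlace w.1 w₁ a) →
          (∀ a, Valued.v (toPlace w.1 w₁ a) ≤ 1 ↔ Valued.v a ≤ 1) →
          (∀ z : (w₁.1.adicCompletion E'), galAdicCompletionMap (L := E') c₁ hw₁ z = z ↔ ∃ a, toPlace w.1 w₁ a = z) →
          (∀ a, Θ (toPlace w.1 w₁ a) = toPlace w.1 w₁ ((galAdicCompletionMap (L := L) (IsCMField.complexConj L) hw) a)) →
          (∀ z, Θ (Θ z) = z) →
          (∀ z, Θ (galAdicCompletionMap (L := E') c₁ hw₁ z) = galAdicCompletionMap (L := E') c₁ hw₁ (Θ z)) →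
          (∀ z, Valued.v (Θ z) = Valued.v z) →
          galAdicCompletionMap (L := E') c₁ hw₁ α ≠ α →
          Valued.v α ≤ 1 →
          (∀ z : (w₁.1.adicCompletion E'), Valued.v z ≤ 1 → Valued.v ((z - galAdicCompletionMap (L := E') c₁ hw₁ z) / (α - galAdicCompletionMap (L := E') c₁ hw₁ α)) ≤ 1) →
          2 * lam = toPlace w.1 w₁ (((γH.1.val : GL (Fin 2) (UnitaryGroup.LocalRing L v)).val.map (Pi.evalRingHom (fun w' : UnitaryGroup.PlacesOver L v => w'.1.adicCompletion L) w))).trace + toPlace w.1 w₁ s * ((δ : E') : (w₁.1.adicCompletion E')) →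
          lam * lam = toPlace w.1 w₁ (((γH.1.val : GL (Fin 2) (UnitaryGroup.LocalRing L v)).val.map (Pi.evalRingHom (fun w' : UnitaryGroup.PlacesOver L v => w'.1.adicCompletion L) w))).trace * lam - toPlace w.1 w₁ (((γH.1.val : GL (Fin 2) (UnitaryGroup.LocalRing L v)).val.map (Pi.evalRingHom (fun w' : UnitaryGroup.PlacesOver L v => w'.1.adicCompletion L) w))).det →
          galAdicCompletionMap (L := E') c₁ hw₁ lam = toPlace w.1 w₁ (((γH.1.val : GL (Fin 2) (UnitaryGroup.LocalRing L v)).val.map (Pi.evalRingHom (fun w' : UnitaryGroup.PlacesOver L v => w'.1.adicCompletion L) w))).trace - lam →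
          Θ lam * lam = 1 →
          Valued.v lam = 1 →
          (∀ z : (w₁.1.adicCompletion E'), ∃! pq : (w.1.adicCompletion L) × (w.1.adicCompletion L), z = toPlace w.1 w₁ pq.1 + toPlace w.1 w₁ pq.2 * lam) →
          ∀ (th ta : ((UnitaryGroup.cmDatum L 3 (Matrix.of fun i j : Fin 3 => if i.val + j.val + 1 = 3 then (1 : L) else 0)).Local v)) (P₁ : GL (Fin 3) (w.1.adicCompletion L)) (dg : Fin 2 → (w.1.adicCompletion L)) (η : (w.1.adicCompletion L)) (γ₁ : GL (Fin 2) (w.1.adicCompletion L)),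
            ((localNonsplitEquiv (IsCMField.complexConj L) (Matrix.of fun i j : Fin 3 => if i.val + j.val + 1 = 3 then (1 : L) else 0) (IsCMField.complexConj_ne_one L) w hw th : ↥(unitaryGroupOfForm (galAdicCompletionMap (L := L) (IsCMField.complexConj L) hw) (placeForm (Matrix.of fun i j : Fin 3 => if i.val + j.val + 1 = 3 then (1 : L) else 0) w.1))) : GL (Fin 3) (w.1.adicCompletion L)) = endoGL (((localNonsplitEquiv (IsCMField.complexConj L) (Matrix.of fun i j : Fin 2 => if i.val + j.val + 1 = 2 then (1 : L) else 0) (IsCMField.complexConj_ne_one L) w hw γH.1 : ↥(unitaryGroupOfForm (galAdicCompletionMap (L := L) (IsCMField.complexConj L) hw) (placeForm (Matrix.of fun i j : Fin 2 => if i.val + j.val + 1 = 2 then (1 : L) else 0) w.1))) : GL (Fin 2) (w.1.adicCompletion L)), ((localNonsplitEquiv (IsCMField.complexConj L) (Matrix.of fun i j : Fin 1 => if i.val + j.val + 1 = 1 then (1 : L) else 0) (IsCMField.complexConj_ne_one L) w hw γH.2).val : GL (Fin 1) (w.1.adicCompletion L))) →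
            ((localNonsplitEquiv (IsCMField.complexConj L) (Matrix.of fun i j : Fin 3 => if i.val + j.val + 1 = 3 then (1 : L) else 0) (IsCMField.complexConj_ne_one L) w hw ta : ↥(unitaryGroupOfForm (galAdicCompletionMap (L := L) (IsCMField.complexConj L) hw) (placeForm (Matrix.of fun i j : Fin 3 => if i.val + j.val + 1 = 3 then (1 : L) else 0) w.1))) : GL (Fin 3) (w.1.adicCompletion L)) = P₁ * endoGL (γ₁, ((localNonsplitEquiv (IsCMField.complexConj L) (Matrix.of fun i j : Fin 1 => if i.val + j.val + 1 = 1 then (1 : L) else 0) (IsCMField.complexConj_ne_one L) w hw γH.2).val : GL (Fin 1) (w.1.adicCompletion L))) * P₁⁻¹ →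
            formCongr (galAdicCompletionMap (L := L) (IsCMField.complexConj L) hw) P₁ (placeForm (Matrix.of fun i j : Fin 3 => if i.val + j.val + 1 = 3 then (1 : L) else 0) w.1) = (!![(Matrix.diagonal dg) 0 0, 0, (Matrix.diagonal dg) 0 1; 0, η, 0; (Matrix.diagonal dg) 1 0, 0, (Matrix.diagonal dg) 1 1] : Matrix (Fin 3) (Fin 3) (w.1.adicCompletion L)) →
            (∀ i, Valued.v (dg i) = 1) →
            (∀ i, (galAdicCompletionMap (L := L) (IsCMField.complexConj L) hw) (dg i) = dg i) →
            (galAdicCompletionMap (L := L) (IsCMField.complexConj L) hw) η = η →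
            Valued.v η = 1 →
            (¬ ∃ t : (w.1.adicCompletion L), t * (galAdicCompletionMap (L := L) (IsCMField.complexConj L) hw) t = η) →
            γ₁ ∈ unitaryGroupOfForm (galAdicCompletionMap (L := L) (IsCMField.complexConj L) hw) (Matrix.diagonal dg) →
            (∀ i j, Valued.v ((γ₁ : Matrix (Fin 2) (Fin 2) (w.1.adicCompletion L)) i j) ≤ 1) →
            (γ₁ : Matrix (Fin 2) (Fin 2) (w.1.adicCompletion L)).charpoly = (((γH.1.val : GL (Fin 2) (UnitaryGroup.LocalRing L v)).val.map (Pi.evalRingHom (fun w' : UnitaryGroup.PlacesOver L v => w'.1.adicCompletion L) w))).charpoly →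
            ∀ (m : ℕ) (β : (v.adicCompletion ↥(maximalRealSubfield L))ˣ), Valued.v (((finCharpolyTwo L v γH).eval (finGammaTwo L v γH)) w) = Valued.v ((toPlace v w (HeckeCharacter.uniformizer ↥(maximalRealSubfield L) v : v.adicCompletion ↥(maximalRealSubfield L))) ^ m) →
              toPlace v w (β : (v.adicCompletion ↥(maximalRealSubfield L))) = -(((finCharpolyTwo L v γH).eval (finGammaTwo L v γH)) w * (finGammaTwo L v γH w ^ 2 + ((γH.1.val.val : Matrix (Fin 2) (Fin 2) (UnitaryGroup.LocalRing L v)).map (Pi.evalRingHom (fun w' : UnitaryGroup.PlacesOver L v => w'.1.adicCompletion L) w)).det)) / (2 * finGammaTwo L v γH w ^ 2 * ((γH.1.val.val : Matrix (Fin 2) (Fin 2) (UnitaryGroup.LocalRing L v)).map (Pi.evalRingHom (fun w' : UnitaryGroup.PlacesOver L v => w'.1.adicCompletion L) w)).det) →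
              (((Fintype.card (Valued.ResidueField (w.1.adicCompletion L))) : ℤ) - 1) * ((({M : Submodule (Valued.integer (w.1.adicCompletion L)) (Fin 3 → (w.1.adicCompletion L)) | IsVertexLattice (galAdicCompletionMap (L := L) (IsCMField.complexConj L) hw) ϖ ((StdForm.antidiagonal 3).over (w.1.adicCompletion L)) 0 M ∧ mapGL ((localNonsplitEquiv (IsCMField.complexConj L) (Matrix.of fun i j : Fin 3 => if i.val + j.val + 1 = 3 then (1 : L) else 0) (IsCMField.complexConj_ne_one L) w hw th : ↥(unitaryGroupOfForm (galAdicCompletionMap (L := L) (IsCMField.complexConj L) hw) (placeForm (Matrix.of fun i j : Fin 3 => if i.val + j.val + 1 = 3 then (1 : L) else 0) w.1))) : GL (Fin 3) (w.1.adicCompletion L)) M = M}.ncard : ℕ) : ℤ) - (({M : Submodule (Valued.integer (w.1.adicCompletion L)) (Fin 3 → (w.1.adicCompletion L)) | IsVertexLattice (galAdicCompletionMap (L := L) (IsCMField.complexConj L) hw) ϖ ((StdForm.antidiagonal 3).over (w.1.adicCompletion L)) 0 M ∧ mapGL ((localNonsplitEquiv (IsCMField.complexConj L) (Matrix.of fun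 i j : Fin 3 => if i.val + j.val + 1 = 3 then (1 : L) else 0) (IsCMField.complexConj_ne_one L) w hw ta : ↥(unitaryGroupOfForm (galAdicCompletionMap (L := L) (IsCMField.complexConj L) hw) (placeForm (Matrix.of fun i j : Fin 3 => if i.val + j.val + 1 = 3 then (1 : L) else 0) w.1))) : GL (Fin 3) (w.1.adicCompletion L)) M = M}.ncard : ℕ) : ℤ)) = (Literature.NumberTheory.QuadraticForms.hilbertSymbol (v.adicCompletion ↥(maximalRealSubfield L)) (β : (v.adicCompletion ↥(maximalRealSubfield L))) (algebraMap ↥(maximalRealSubfield L) _ ((cmQuadraticGenerator L : 𝓞 ↥(maximalRealSubfield L)) : ↥(maximalRealSubfield L))) : ℤ) * ((Fintype.card (Valued.ResidueField (w.1.adicCompletion L))) : ℤ) ^ m * ((((Fintype.card (Valued.ResidueField (w.1.adicCompletion L))) : ℤ) - 1) * (((Nat.card (MulAction.fixedBy (((UnitaryGroup.cmDatum L 2 (Matrix.of fun i j : Fin 2 => if i.val + j.val + 1 = 2 then (1 : L) else 0)).Local v) ⧸ cmLocalIntegralLevel L 2 (Matrix.of fun i j : Fin 2 => if i.val + j.val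 + 1 = 2 then (1 : L) else 0) v) γH.1)) + d % 2 : ℕ) : ℤ) - 2 * (((Fintype.card (Valued.ResidueField (w.1.adicCompletion L))) : ℤ) ^ (d - d % 2) - 1))) :
    ∃ V ∈ 𝓝 (1 : ((UnitaryGroup.cmDatum L 2 (Matrix.of fun i j : Fin 2 => if i.val + j.val + 1 = 2 then (1 : L) else 0)).Local v × (UnitaryGroup.cmDatum L 1 (Matrix.of fun i j : Fin 1 => if i.val + j.val + 1 = 1 then (1 : L) else 0)).Local v)), ∀ γH ∈ V, IsLocalGRegular L v γH →
      ¬ (∃ x : (w.1.adicCompletion L), (((((γH).1.val : GL (Fin 2) (UnitaryGroup.LocalRing L v)).val.map (Pi.evalRingHom (fun w' : UnitaryGroup.PlacesOver L v => w'.1.adicCompletion L) w))).charpoly).IsRoot x) →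
      ∀ (th ta : ((UnitaryGroup.cmDatum L 3 (Matrix.of fun i j : Fin 3 => if i.val + j.val + 1 = 3 then (1 : L) else 0)).Local v)) (P₁ : GL (Fin 3) (w.1.adicCompletion L)) (dg : Fin 2 → (w.1.adicCompletion L)) (η : (w.1.adicCompletion L)) (γ₁ : GL (Fin 2) (w.1.adicCompletion L)),
        ((localNonsplitEquiv (IsCMField.complexConj L) (Matrix.of fun i j : Fin 3 => if i.val + j.val + 1 = 3 then (1 : L) else 0) (IsCMField.complexConj_ne_one L) w hw th : ↥(unitaryGroupOfForm (galAdicCompletionMap (L := L) (IsCMField.complexConj L) hw) (placeForm (Matrix.of fun i j : Fin 3 => if i.val + j.val + 1 = 3 then (1 : L) else 0) w.1))) : GL (Fin 3) (w.1.adicCompletion L)) = endoGL (((localNonsplitEquiv (IsCMField.complexConj L) (Matrix.of fun i j : Fin 2 => if i.val + j.val + 1 = 2 then (1 : L) else 0) (IsCMField.complexConj_ne_one L) w hw γH.1 : ↥(unitaryGroupOfForm (galAdicCompletionMap (L := L) (IsCMField.complexConj L) hw) (placeForm (Matrix.of fun i j : Fin 2 => if i.val + j.val + 1 = 2 then (1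 : L) else 0) w.1))) : GL (Fin 2) (w.1.adicCompletion L)), ((localNonsplitEquiv (IsCMField.complexConj L) (Matrix.of fun i j : Fin 1 => if i.val + j.val + 1 = 1 then (1 : L) else 0) (IsCMField.complexConj_ne_one L) w hw γH.2).val : GL (Fin 1) (w.1.adicCompletion L))) →
        ((localNonsplitEquiv (IsCMField.complexConj L) (Matrix.of fun i j : Fin 3 => if i.val + j.val + 1 = 3 then (1 : L) else 0) (IsCMField.complexConj_ne_one L) w hw ta : ↥(unitaryGroupOfForm (galAdicCompletionMap (L := L) (IsCMField.complexConj L) hw) (placeForm (Matrix.of fun i j : Fin 3 => if i.val + j.val + 1 = 3 then (1 : L) else 0) w.1))) : GL (Fin 3) (w.1.adicCompletion L)) = P₁ * endoGL (γ₁, ((localNonsplitEquiv (IsCMField.complexConj L) (Matrix.of fun i j : Fin 1 => if i.val + j.val + 1 = 1 then (1 : L) else 0) (IsCMField.complexConj_ne_one L) w hw γH.2).val : GL (Fin 1) (w.1.adicCompletion L))) * P₁⁻¹ →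
        formCongr (galAdicCompletionMap (L := L) (IsCMField.complexConj L) hw) P₁ (placeForm (Matrix.of fun i j : Fin 3 => if i.val + j.val + 1 = 3 then (1 : L) else 0) w.1) = (!![(Matrix.diagonal dg) 0 0, 0, (Matrix.diagonal dg) 0 1; 0, η, 0; (Matrix.diagonal dg) 1 0, 0, (Matrix.diagonal dg) 1 1] : Matrix (Fin 3) (Fin 3) (w.1.adicCompletion L)) →
        (∀ i, Valued.v (dg i) = 1) →
        (∀ i, (galAdicCompletionMap (L := L) (IsCMField.complexConj L) hw) (dg i) = dg i) →
        (galAdicCompletionMap (L := L) (IsCMField.complexConj L) hw) η = η →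
        Valued.v η = 1 →
        (¬ ∃ t : (w.1.adicCompletion L), t * (galAdicCompletionMap (L := L) (IsCMField.complexConj L) hw) t = η) →
        γ₁ ∈ unitaryGroupOfForm (galAdicCompletionMap (L := L) (IsCMField.complexConj L) hw) (Matrix.diagonal dg) →
        (∀ i j, Valued.v ((γ₁ : Matrix (Fin 2) (Fin 2) (w.1.adicCompletion L)) i j) ≤ 1) →
        (γ₁ : Matrix (Fin 2) (Fin 2) (w.1.adicCompletion L)).charpoly = (((γH.1.val : GL (Fin 2) (UnitaryGroup.LocalRing L v)).val.map (Pi.evalRingHom (fun w' : UnitaryGroup.PlacesOver L v => w'.1.adicCompletion L) w))).charpoly →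
        ∀ (m : ℕ) (β : (v.adicCompletion ↥(maximalRealSubfield L))ˣ), Valued.v (((finCharpolyTwo L v γH).eval (finGammaTwo L v γH)) w) = Valued.v ((toPlace v w (HeckeCharacter.uniformizer ↥(maximalRealSubfield L) v : v.adicCompletion ↥(maximalRealSubfield L))) ^ m) →
          toPlace v w (β : (v.adicCompletion ↥(maximalRealSubfield L))) = -(((finCharpolyTwo L v γH).eval (finGammaTwo L v γH)) w * (finGammaTwo L v γH w ^ 2 + ((γH.1.val.val : Matrix (Fin 2) (Fin 2) (UnitaryGroup.LocalRing L v)).map (Pi.evalRingHom (fun w' : UnitaryGroup.PlacesOver L v => w'.1.adicCompletion L) w)).det)) / (2 * finGammaTwo L v γH w ^ 2 * ((γH.1.val.val : Matrix (Fin 2) (Fin 2) (UnitaryGroup.LocalRing L v)).map (Pi.evalRingHom (fun w' : UnitaryGroup.PlacesOver L v => w'.1.adicCompletion L) w)).det) →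
          (((Fintype.card (Valued.ResidueField (w.1.adicCompletion L))) : ℤ) - 1) * ((({M : Submodule (Valued.integer (w.1.adicCompletion L)) (Fin 3 → (w.1.adicCompletion L)) | IsVertexLattice (galAdicCompletionMap (L := L) (IsCMField.complexConj L) hw) ϖ ((StdForm.antidiagonal 3).over (w.1.adicCompletion L)) 0 M ∧ mapGL ((localNonsplitEquiv (IsCMField.complexConj L) (Matrix.of fun i j : Fin 3 => if i.val + j.val + 1 = 3 then (1 : L) else 0) (IsCMField.complexConj_ne_one L) w hw th : ↥(unitaryGroupOfForm (galAdicCompletionMap (L := L) (IsCMField.complexConj L) hw) (placeForm (Matrix.of fun i j : Fin 3 => if i.val + j.val + 1 = 3 then (1 : L) else 0) w.1))) : GL (Fin 3) (w.1.adicCompletion L)) M = M}.ncard : ℕ) : ℤ) - (({M : Submodule (Valued.integer (w.1.adicCompletion L)) (Fin 3 → (w.1.adicCompletion L)) | IsVertexLattice (galAdicCompletionMap (L := L) (IsCMField.complexConj L) hw) ϖ ((StdForm.antidiagonal 3).over (w.1.adicCompletion L)) 0 M ∧ mapGL ((localNonsplitEquiv (IsCMField.complexConj L) (Matrix.of fun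 i j : Fin 3 => if i.val + j.val + 1 = 3 then (1 : L) else 0) (IsCMField.complexConj_ne_one L) w hw ta : ↥(unitaryGroupOfForm (galAdicCompletionMap (L := L) (IsCMField.complexConj L) hw) (placeForm (Matrix.of fun i j : Fin 3 => if i.val + j.val + 1 = 3 then (1 : L) else 0) w.1))) : GL (Fin 3) (w.1.adicCompletion L)) M = M}.ncard : ℕ) : ℤ)) = (Literature.NumberTheory.QuadraticForms.hilbertSymbol (v.adicCompletion ↥(maximalRealSubfield L)) (β : (v.adicCompletion ↥(maximalRealSubfield L))) (algebraMap ↥(maximalRealSubfield L) _ ((cmQuadraticGenerator L : 𝓞 ↥(maximalRealSubfield L)) : ↥(maximalRealSubfield L))) : ℤ) * ((Fintype.card (Valued.ResidueField (w.1.adicCompletion L))) : ℤ) ^ m * ((((Fintype.card (Valued.ResidueField (w.1.adicCompletion L))) : ℤ) - 1) * (((Nat.card (MulAction.fixedBy (((UnitaryGroup.cmDatum L 2 (Matrix.of fun i j : Fin 2 => if i.val + j.val + 1 = 2 then (1 : L) else 0)).Local v) ⧸ cmLocalIntegralLevel L 2 (Matrix.of fun i j : Fin 2 => if i.val + j.val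 + 1 = 2 then (1 : L) else 0) v) γH.1)) + d % 2 : ℕ) : ℤ) - 2 * (((Fintype.card (Valued.ResidueField (w.1.adicCompletion L))) : ℤ) ^ (d - d % 2) - 1)) := by
  classical
  haveI : Algebra.IsQuadraticExtension ↥(maximalRealSubfield L) L := IsCMField.isQuadraticExtension L
  haveI : CharZero (w.1.adicCompletion L) := charZero_of_injective_algebraMap (algebraMap L (w.1.adicCompletion L)).injective
  have hc1 : IsCMField.complexConj L ≠ 1 := IsCMField.complexConj_ne_one L
  obtain ⟨VF, hVF, hF⟩ := hFrame
  refine ⟨VF, hVF, fun γH hγ hreg hirr th ta P₁ dg η γ₁ hth hA1 hA2 hA3 hA4 hA7 hA8 hA9 hA10 hA11 hA12 m β hm hβ => ?_⟩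
  -- the one-place matrix `g_w` of `γ_H.1`, its trace `t` and determinant `D`; `σ := σ_w`
  set σ : (w.1.adicCompletion L) →+* (w.1.adicCompletion L) := (galAdicCompletionMap (L := L) (IsCMField.complexConj L) hw) with hσdef
  set g : Matrix (Fin 2) (Fin 2) (w.1.adicCompletion L) := ((γH.1.val : GL (Fin 2) (UnitaryGroup.LocalRing L v)).val.map (Pi.evalRingHom (fun w' : UnitaryGroup.PlacesOver L v => w'.1.adicCompletion L) w)) with hgdef
  have hσσ : ∀ a, σ (σ a) = a := galAdicCompletionMap_galAdicCompletionMap_of_smul_eq (IsCMField.complexConj L) w hc1 hw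
  have hσv : ∀ a, Valued.v (σ a) = Valued.v a := fun a => valued_galAdicCompletionMap (L := L) (IsCMField.complexConj L) hw a
  -- `g_w` is unitary for `Φ₂,w = antidiag(1,1)` ⇒ `D·σD = 1`, `t = D·σt`
  have hgunit : (g.map σ)ᵀ * (!![0, 1; 1, 0] : Matrix (Fin 2) (Fin 2) (w.1.adicCompletion L)) * g = !![0, 1; 1, 0] := by
    have h := transpose_map_fst_evalRingHom_mul L v w hw γH
    rw [UnitaryGroup.placeForm_antidiagTwo_eq_antidiag L v w] at h
    exact h
  have hDσ : g.det * σ g.det = 1 := det_mul_map_det_eq_one_of_unitary_antidiag σ g hgunit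
  have hσt : σ g.trace = g.trace * σ g.det := by
    have h := map_trace_mul_det_eq_trace_of_unitary_antidiag σ g hgunit
    calc σ g.trace = σ g.trace * (g.det * σ g.det) := by rw [hDσ, mul_one]
      _ = σ g.trace * g.det * σ g.det := by ring
      _ = g.trace * σ g.det := by rw [h]
  have htσ : g.trace = g.det * σ g.trace := by
    calc g.trace = g.trace * (g.det * σ g.det) := by rw [hDσ, mul_one]
      _ = g.det * (g.trace * σ g.det) := by ring
      _ = g.det * σ g.trace := by rw [← hσt]
  -- type (2): `χ_g(x) = x² − t·x + D ≠ 0` for every `x ∈ L_w`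
  have hirr' : ∀ x : (w.1.adicCompletion L), x * x - g.trace * x + g.det ≠ 0 := by
    intro x hx
    apply hirr
    refine ⟨x, ?_⟩
    rw [Matrix.charpoly_fin_two, Polynomial.IsRoot.def]
    simp only [eval_add, eval_sub, eval_pow, eval_X, eval_mul, eval_C]
    linear_combination hx
  -- `Δ := t² − 4D ≠ 0` (else `t∕2` is a root)
  have h20 : (2 : (w.1.adicCompletion L)) ≠ 0 := two_ne_zero
  have hΔ0 : g.trace * g.trace - 4 * g.det ≠ 0 := by
    intro h0
    apply hirr' (g.trace / 2)
    have e : g.trace / 2 * (g.trace / 2) - g.trace * (g.trace / 2) + g.det = -(g.trace * g.trace - 4 * g.det) / 4 := by ring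
    rw [e, h0, neg_zero, zero_div]
  -- a global representative `m₀` of the square class of `Δ`, and `E′ = L(√m₀)`
  obtain ⟨m₀, hm₀0, r, hr⟩ := exists_isSquare_inv_mul_coe_of_ne_zero w.1 hΔ0
  have hm₀E : algebraMap L (w.1.adicCompletion L) m₀ ≠ 0 := (_root_.map_ne_zero (algebraMap L (w.1.adicCompletion L))).2 hm₀0
  have hr0 : r ≠ 0 := by
    intro h0
    rw [h0, mul_zero] at hr
    exact mul_ne_zero (inv_ne_zero hΔ0) hm₀E hr
  have hΔ : g.trace * g.trace - 4 * g.det = r⁻¹ * r⁻¹ * ((m₀ : L) : (w.1.adicCompletion L)) := by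
    have h1 : algebraMap L (w.1.adicCompletion L) m₀ = (g.trace * g.trace - 4 * g.det) * (r * r) := by
      rw [← hr, ← mul_assoc, mul_inv_cancel₀ hΔ0, one_mul]
    have h2 : ((m₀ : L) : (w.1.adicCompletion L)) = algebraMap L (w.1.adicCompletion L) m₀ := rfl
    rw [h2, h1]
    field_simp
  have hns : ¬ IsSquare (algebraMap L (w.1.adicCompletion L) m₀) := by
    rintro ⟨b, hb⟩
    have h2 : ((m₀ : L) : (w.1.adicCompletion L)) = algebraMap L (w.1.adicCompletion L) m₀ := rfl
    rw [h2, hb] at hΔ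
    apply hirr' ((g.trace + r⁻¹ * b) / 2)
    have e : (g.trace + r⁻¹ * b) / 2 * ((g.trace + r⁻¹ * b) / 2) - g.trace * ((g.trace + r⁻¹ * b) / 2) + g.det =
        (r⁻¹ * r⁻¹ * (b * b) - (g.trace * g.trace - 4 * g.det)) / 4 := by ring
    rw [e, ← hΔ, sub_self, zero_div]
  have hnsq : ¬ IsSquare m₀ := not_isSquare_of_not_isSquare_algebraMap m₀ hns
  haveI : Fact (Irreducible (X ^ 2 - C m₀ : L[X])) := ⟨irreducible_X_sq_sub_C_of_not_isSquare m₀ hnsq⟩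
  haveI : NumberField (AdjoinRoot (X ^ 2 - C m₀ : L[X])) := numberField_adjoinRoot m₀
  haveI : Algebra.IsQuadraticExtension L (AdjoinRoot (X ^ 2 - C m₀ : L[X])) := isQuadraticExtension_adjoinRoot m₀
  obtain ⟨c₁, hc₁, hc₁1⟩ := exists_algEquiv_root_eq_neg m₀
  have hδ0 : AdjoinRoot.root (X ^ 2 - C m₀ : L[X]) ≠ 0 := root_X_sq_sub_C_ne_zero m₀
  have hmδ : algebraMap L (AdjoinRoot (X ^ 2 - C m₀ : L[X])) m₀ = (AdjoinRoot.root (X ^ 2 - C m₀ : L[X])) ^ 2 := (root_X_sq_sub_C_sq m₀).symm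
  -- the eigen-package (★ p857432) and the frame census
  obtain ⟨w₁, hw₁, Θ, α, lam, hP1, hP2, hP3, hP4, hP5, hP6, hP7, hP8, hP9, hP10, hP11, hP12, hP13, hP14, hP15, hP16, hP17, hP18⟩ :=
    F0P3cDyRamEigenFieldPackageTypeTwo.exists_eigenPackage (AdjoinRoot (X ^ 2 - C m₀ : L[X])) w.1 c₁ hc₁1 hc₁ hδ0 hmδ σ hσσ hσv (inv_ne_zero hr0) hΔ hDσ htσ hirr'
  exact hF γH hγ hreg hirr (AdjoinRoot (X ^ 2 - C m₀ : L[X])) c₁ (AdjoinRoot.root (X ^ 2 - C m₀ : L[X])) m₀ r⁻¹ w₁ hw₁ Θ α lam hc₁1 hc₁ hδ0 hmδ (inv_ne_zero hr0) hΔ hDσ htσ hirr'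
    hP1 hP2 hP3 hP4 hP5 hP6 hP7 hP8 hP9 hP10 hP11 hP12 hP13 hP14 hP15 hP16 hP17 hP18 th ta P₁ dg η γ₁ hth hA1 hA2 hA3 hA4 hA7 hA8 hA9 hA10 hA11 hA12 m β hm hβ

end Summit.HodgeConjecture.HodgeConjecture.Cruxes.H413.F0P3cDyRamFixedPointCensusTypeTwoCensusOfFrame

end
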